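import Literature.NumberTheory.PAdicHodge.AinfRamifiedComplete
import Literature.NumberTheory.PAdicHodge.AinfTopology
import HarnessLib

/-!
# `A_inf(𝒪) = 𝔸_inf(F)[ϖ]` as a topological ring: the `(p, ω)`-adic topology, continuity of `θ_𝒪` and of `Γ_F`,
# and the nil ideal `𝔫_𝒪 = θ_𝒪⁻¹(𝔪_{ℂ_F})`

Topic `Literature/NumberTheory/PAdicHodge`; the ramified twin of `AinfTopology` (which is the case `𝒪 = ℤ_p`), sequel
of `AinfRamifiedComplete` (`A_inf(𝒪)` is `(p, ξ)`-adically complete, `ω^{2e-1} ∈ (p, ξ)`) and `AinfRamifiedKernel`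
(`ker θ_𝒪 = (ω)`).

For an Eisenstein root datum `D = (f, ϖ)` over the `p`-adic field `F`, the ring `A_inf(𝒪) = 𝔸_inf(F)[ϖ]` of points of
`𝒪`-formal groups carries the adic topology of the ideal of definition **`𝔦 = (p, ω)`**, `ω = ϖ − [ϖ♭]` — the
analogue of Fontaine's `(p, ξ)` with the SAME three properties used by every period construction downstream:
`ker θ_𝒪 = (ω) ⊆ 𝔦`, `θ_𝒪(𝔦ⁿ) ⊆ pⁿ𝒪_{ℂ_F}`, `p ∈ 𝔦`; it defines the same topology as `(p, ξ)A_inf(𝒪)`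
(`(p, ξ) ⊆ 𝔦`, `𝔦^{2e} ⊆ (p, ξ)`).

* §0 (commutative algebra) `IsAdicComplete` transfers between ideals `J ≤ I` with `I^N ≤ J`
  (`isAdicComplete_of_ge_of_pow_le`).
* §1 `AinfRamTop D` — the type synonym of `A_inf(𝒪)` with the `𝔦`-adic topology (Mathlib `WithIdeal`): complete,
  Hausdorff, linearly topologised; ideals containing a power of `𝔦` are open and closed.
* §2 `AinfRamTop.theta` — `θ_𝒪 : A_inf(𝒪) → 𝒪_{ℂ_F}` as a CONTINUOUS ring homomorphism to the closed unit ball `CBall F`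
  (`θ_𝒪(𝔦ⁿ) ⊆ pⁿ𝒪_{ℂ_F}`), and `AinfRamTop.gal σ` — `σ ∈ Γ_F` as a continuous ring endomorphism (`σ(𝔦) ⊆ 𝔦` since
  `σ(ω) ∈ ker θ_𝒪 = (ω)`); `θ_𝒪(a) = θ_𝒪(b) ⟹ a − b ∈ 𝔦`.
* §3 `AinfRamTop.nilTheta` — the closed ideal `𝔫_𝒪 = θ_𝒪⁻¹(𝔪_{ℂ_F})` of topologically nilpotent elements
  (`‖θ_𝒪(a)‖ < 1 ⟹ aᴺ ∈ 𝔦`) as a `LubinTate.NilIdeal` (the domain of `LubinTate.evalPt`); `𝔦 ⊆ 𝔫_𝒪`,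
  `θ_𝒪 : 𝔫_𝒪 → 𝔪_{ℂ_F}` onto, `𝔫_𝒪` is `Γ_F`-stable, `ϖ ∈ 𝔫_𝒪`.

Definitions (reviewed): `AinfRamTop`, `AinfRamTop.of`, `.theta`, `.gal`, `.nilTheta`, and the ring / `WithIdeal` /
topological instances on the NEW type `AinfRamTop D` (as in `AinfTopology`). No named facts, no `sorry`.
Infrastructure for hDR over a ramified base; nothing about elliptic curves is proved here.

## References
* [FontaineAsterisque223III] J.-M. Fontaine, *Le corps des périodes p-adiques*, Astérisque 223 (1994), Exp. II §1.3
  (topology of `A_inf`), §1.2 (`θ`).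
* [FarguesFontaine2018] L. Fargues, J.-M. Fontaine, Astérisque 406 (2018), §1.2, §2.2 (`W_{𝒪_E}`, `θ`, `π − [π♭]`).
* [StacksProject] Tag 0317 (adic completeness).
* [CasselsFrohlichANT1967] J.-P. Serre, *Local class field theory* (Cassels–Fröhlich Ch. VI) §3.2.
-/

noncomputable section

open Ideal WittVector MvPowerSeries Field ValuativeRel

namespace Literature.NumberTheory.PAdicHodge

open Literature.NumberTheory.GaloisRepresentations
open Literature.NumberTheory.GaloisRepresentations.IsNonarchimedeanLocalField
open Literature.NumberTheory.GaloisRepresentations.LubinTate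

/-! ## §0 Adic completeness for commensurable ideals -/

section Transfer

variable {R : Type*} [CommRing R] {I J : Ideal R}

/-- **`IsAdicComplete` is insensitive to replacing the ideal by a commensurable one**: if `J ≤ I` and `I^N ≤ J`
(`N ≥ 1`), then `J`-adic completeness implies `I`-adic completeness. [cite: StacksProject, Tag 0317] -/
theorem isAdicComplete_of_ge_of_pow_le {N : ℕ} (hN : 0 < N) (hJI : J ≤ I) (hIJ : I ^ N ≤ J) [IsAdicComplete J R] :
    IsAdicComplete I R := by
  have hpow : ∀ n : ℕ, I ^ (N * n) ≤ J ^ n := fun n => by rw [pow_mul]; exact Ideal.pow_right_mono hIJ n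
  have hpow' : ∀ n : ℕ, J ^ n ≤ I ^ n := fun n => Ideal.pow_right_mono hJI n
  refine { toIsHausdorff := ⟨fun x hx => ?_⟩, toIsPrecomplete := ⟨fun f hf => ?_⟩ }
  · refine IsHausdorff.haus (IsAdicComplete.toIsHausdorff (I := J)) x fun n => ?_
    have h := hx (N * n)
    rw [SModEq.zero, smul_eq_mul, Ideal.mul_top] at h ⊢
    exact hpow n h
  · have hg : ∀ {m n : ℕ}, m ≤ n → f (N * m) ≡ f (N * n) [SMOD (J ^ m • ⊤ : Submodule R R)] := by
      intro m n hmn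
      have h := hf (Nat.mul_le_mul_left N hmn)
      rw [SModEq.sub_mem, smul_eq_mul, Ideal.mul_top] at h ⊢
      exact hpow m h
    obtain ⟨L, hL⟩ := IsPrecomplete.prec (IsAdicComplete.toIsPrecomplete (I := J)) hg
    refine ⟨L, fun n => ?_⟩
    have h1 : f n ≡ f (N * n) [SMOD (I ^ n • ⊤ : Submodule R R)] := hf (Nat.le_mul_of_pos_left n hN)
    have h2 := hL n
    rw [SModEq.sub_mem, smul_eq_mul, Ideal.mul_top] at h1 h2 ⊢
    have : f n - L = (f n - f (N * n)) + (f (N * n) - L) := by ring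
    rw [this]
    exact Ideal.add_mem _ h1 (hpow' n h2)

end Transfer

variable {F : Type} [Field F] [ValuativeRel F] [TopologicalSpace F] [IsNonarchimedeanLocalField F] [CharZero F]
  {p : ℕ} [Fact p.Prime] [Fact (¬ IsUnit (p : integerC F))] {hp : valuation F p < 1}

/-! ## §1 `A_inf(𝒪)` with its `(p, ω)`-adic topology -/

/-- **`A_inf(𝒪)` as a topological ring**: the type synonym of `A_inf(𝒪) = 𝔸_inf(F)[ϖ]` carrying the `(p, ω)`-adic
(`= (p, ξ)`-adic `= (ϖ, [ϖ♭])`-adic) topology. [cite: FontaineAsterisque223III, Exp. II §1.3.1] [cite: FarguesFontaine2018, §1.2] -/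
def AinfRamTop (D : EisensteinRoot F p hp) : Type := AinfRam D

namespace AinfRamTop

variable (D : EisensteinRoot F p hp)

/-- Ring structure (that of `A_inf(𝒪)`). [folklore] -/
instance : CommRing (AinfRamTop D) := inferInstanceAs (CommRing (AinfRam D))

/-- The preferred ideal `𝔦 = (p, ω)`, giving the adic topology, uniformity and linear topology through Mathlib's
`WithIdeal`. [cite: FontaineAsterisque223III, Exp. II §1.3.1] -/
instance : WithIdeal (AinfRamTop D) := ⟨(Ideal.span {(p : AinfRam D), AinfRam.omega D} : Ideal (AinfRam D))⟩

/-- The identification `A_inf(𝒪) = AinfRamTop D` (identity). [folklore] -/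
def of : AinfRam D ≃+* AinfRamTop D := RingEquiv.refl _

/-- The defining ideal is `(p, ω)`. [cite: FontaineAsterisque223III, Exp. II §1.3.1] -/
theorem ideal_eq : (WithIdeal.i : Ideal (AinfRamTop D)) = Ideal.span {(p : AinfRamTop D), of D (AinfRam.omega D)} := rfl

/-- The topology is the `(p, ω)`-adic one. [cite: FontaineAsterisque223III, Exp. II §1.3.1] -/
theorem isAdic : IsAdic (WithIdeal.i : Ideal (AinfRamTop D)) := rfl

/-- `p ∈ 𝔦`. [cite: FontaineAsterisque223III, Exp. II §1.3.1] -/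
theorem natCast_mem_ideal : ((p : ℕ) : AinfRamTop D) ∈ (WithIdeal.i : Ideal (AinfRamTop D)) := by
  rw [ideal_eq]; exact Ideal.subset_span (Set.mem_insert _ _)

/-- `ω ∈ 𝔦`. [cite: FarguesFontaine2018, §2.2] -/
theorem of_omega_mem_ideal : of D (AinfRam.omega D) ∈ (WithIdeal.i : Ideal (AinfRamTop D)) := by
  rw [ideal_eq]; exact Ideal.subset_span (Set.mem_insert_of_mem _ rfl)

/-- `ker θ_𝒪 = (ω) ⊆ 𝔦`: multiples of `ω` lie in `𝔦`. [cite: FarguesFontaine2018, §2.2] -/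
theorem of_mem_ideal_of_omega_dvd {x : AinfRam D} (h : AinfRam.omega D ∣ x) : of D x ∈ (WithIdeal.i : Ideal (AinfRamTop D)) := by
  obtain ⟨c, rfl⟩ := h
  exact Ideal.mul_mem_right _ _ (of_omega_mem_ideal D)

variable [IsAdicComplete (Ideal.span {(p : integerC F)}) (integerC F)]

/-- `(p, ξ) A_inf(𝒪) ⊆ 𝔦` (`ξ ∈ ω A_inf(𝒪)`). [cite: FarguesFontaine2018, §2.2] -/
theorem map_idealPXi_le : (AinfRam.idealPXi D).map (of D).toRingHom ≤ (WithIdeal.i : Ideal (AinfRamTop D)) := by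
  rw [AinfRam.idealPXi_eq_span, Ideal.map_span, Ideal.span_le]
  rintro _ ⟨y, hy, rfl⟩
  simp only [Set.mem_insert_iff, Set.mem_singleton_iff] at hy
  rcases hy with rfl | rfl
  · rw [RingEquiv.toRingHom_eq_coe, RingHom.coe_coe, map_natCast]; exact natCast_mem_ideal D
  · exact of_mem_ideal_of_omega_dvd D (AinfRam.omega_dvd_xi D)

/-- `𝔦^{2e} ⊆ (p, ξ) A_inf(𝒪)` (`ω^{2e-1} ∈ (p, ξ)`). [cite: FarguesFontaine2018, §1.2] -/
theorem ideal_pow_le_map_idealPXi :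
    (WithIdeal.i : Ideal (AinfRamTop D)) ^ (1 + (D.e + D.e - 1)) ≤ (AinfRam.idealPXi D).map (of D).toRingHom := by
  rw [ideal_eq, Ideal.span_insert]
  refine (Ideal.sup_pow_add_le_pow_sup_pow).trans (sup_le ?_ ?_)
  · rw [pow_one, Ideal.span_singleton_le_iff_mem]
    have h := Ideal.mem_map_of_mem (of D).toRingHom (AinfRam.natCast_mem_idealPXi D)
    rwa [RingEquiv.toRingHom_eq_coe, RingHom.coe_coe, map_natCast] at h
  · rw [Ideal.span_singleton_pow, Ideal.span_singleton_le_iff_mem, ← map_pow]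
    exact Ideal.mem_map_of_mem (of D).toRingHom (AinfRam.omega_pow_mem_idealPXi D)

/-- `A_inf(𝒪)` is `𝔦`-adically complete and separated. [cite: FontaineAsterisque223III, Exp. II §1.3.2] -/
theorem isAdicComplete_ideal : IsAdicComplete (WithIdeal.i : Ideal (AinfRamTop D)) (AinfRamTop D) := by
  haveI : IsAdicComplete ((AinfRam.idealPXi D).map (of D)) (AinfRamTop D) :=
    (IsAdicComplete.congr_ringEquiv (I := AinfRam.idealPXi D) (of D)).2 (AinfRam.isAdicComplete_idealPXi D)
  exact isAdicComplete_of_ge_of_pow_le (J := (AinfRam.idealPXi D).map (of D)) (Nat.succ_pos _) (map_idealPXi_le D) (by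
    have h := ideal_pow_le_map_idealPXi D; rwa [Nat.one_add] at h)

/-- **`A_inf(𝒪)` is complete** for the `(p, ω)`-adic topology. [cite: FontaineAsterisque223III, Exp. II §1.3.2] -/
instance : CompleteSpace (AinfRamTop D) := ((isAdic D).isAdicComplete_iff.1 (isAdicComplete_ideal D)).1

/-- **`A_inf(𝒪)` is Hausdorff** for the `(p, ω)`-adic topology. [cite: FontaineAsterisque223III, Exp. II §1.3.2] -/
instance : T2Space (AinfRamTop D) := ((isAdic D).isAdicComplete_iff.1 (isAdicComplete_ideal D)).2

variable {D}

omit [IsAdicComplete (Ideal.span {(p : integerC F)}) (integerC F)] in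
/-- Powers of `𝔦` are neighbourhoods of `0`. [cite: FontaineAsterisque223III, Exp. II §1.3.1] -/
theorem pow_mem_nhds_zero (n : ℕ) : ((WithIdeal.i ^ n : Ideal (AinfRamTop D)) : Set (AinfRamTop D)) ∈ nhds 0 :=
  (Ideal.hasBasis_nhds_zero_adic (WithIdeal.i : Ideal (AinfRamTop D))).mem_of_mem trivial

omit [IsAdicComplete (Ideal.span {(p : integerC F)}) (integerC F)] in
/-- An ideal containing a power of `𝔦` is open. [cite: FontaineAsterisque223III, Exp. II §1.3.1] -/
theorem isOpen_of_pow_le {J : Ideal (AinfRamTop D)} {n : ℕ} (h : WithIdeal.i ^ n ≤ J) : IsOpen (J : Set (AinfRamTop D)) :=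
  J.toAddSubgroup.isOpen_of_mem_nhds (Filter.mem_of_superset (pow_mem_nhds_zero n) h)

omit [IsAdicComplete (Ideal.span {(p : integerC F)}) (integerC F)] in
/-- An ideal containing a power of `𝔦` is closed. [cite: FontaineAsterisque223III, Exp. II §1.3.1] -/
theorem isClosed_of_pow_le {J : Ideal (AinfRamTop D)} {n : ℕ} (h : WithIdeal.i ^ n ≤ J) : IsClosed (J : Set (AinfRamTop D)) :=
  (⟨J.toAddSubgroup, isOpen_of_pow_le h⟩ : OpenAddSubgroup (AinfRamTop D)).isClosed

omit [IsAdicComplete (Ideal.span {(p : integerC F)}) (integerC F)] in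
/-- An element some power of which lies in `𝔦` is topologically nilpotent. [cite: FontaineAsterisque223III, Exp. II §1.3] -/
theorem isTopologicallyNilpotent_of_pow_mem {a : AinfRamTop D} {N : ℕ} (h : a ^ N ∈ (WithIdeal.i : Ideal (AinfRamTop D))) :
    IsTopologicallyNilpotent a := by
  rw [IsTopologicallyNilpotent, (Ideal.hasBasis_nhds_zero_adic (WithIdeal.i : Ideal (AinfRamTop D))).tendsto_right_iff]
  intro m _
  rw [Filter.eventually_atTop]
  refine ⟨N * m, fun n hn => ?_⟩
  obtain ⟨k, rfl⟩ := Nat.exists_eq_add_of_le hn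
  change a ^ (N * m + k) ∈ (WithIdeal.i ^ m : Ideal (AinfRamTop D))
  rw [pow_add, pow_mul]
  exact Ideal.mul_mem_right _ _ (Ideal.pow_mem_pow h m)

/-! ## §2 `θ_𝒪` and the `Γ_F`-action as continuous ring homomorphisms -/

variable (D)

/-- **`θ_𝒪 : A_inf(𝒪) → 𝒪_{ℂ_F}`** on the topological ring `AinfRamTop D`, valued in the closed unit ball `CBall F` of
`ℂ_F`. [cite: FarguesFontaine2018, §2.2] [cite: FontaineAsterisque223III, Exp. II §1.2.2] -/
def theta : AinfRamTop D →+* CBall F :=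
  (integerCEquivCBall (F := F)).toRingHom.comp ((AinfRam.theta D).comp (of D).symm.toRingHom)

variable {D}

/-- Unfolding `theta` in `ℂ_F`. [cite: FontaineAsterisque223III, Exp. II §1.2.2] -/
theorem coe_theta (a : AinfRam D) :
    ((theta D (of D a) : CBall F) : CompletedAlgClosure F) = (AinfRam.theta D a : integerC F) := rfl

/-- `θ_𝒪(p) = p`, `θ_𝒪(ω) = 0`: `θ_𝒪` maps `𝔦` into `p𝒪_{ℂ_F}`, hence `𝔦ⁿ` into `pⁿ𝒪_{ℂ_F}`.
[cite: FontaineAsterisque223III, Exp. II §1.2.2] -/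
theorem theta_mem_span_pow_of_mem_pow {n : ℕ} {a : AinfRamTop D} (ha : a ∈ (WithIdeal.i ^ n : Ideal (AinfRamTop D))) :
    theta D a ∈ Ideal.span {(p : CBall F)} ^ n := by
  have hmap : (WithIdeal.i : Ideal (AinfRamTop D)).map (theta D) ≤ Ideal.span {(p : CBall F)} := by
    rw [ideal_eq, Ideal.map_span, Ideal.span_le]
    rintro _ ⟨y, hy, rfl⟩
    simp only [Set.mem_insert_iff, Set.mem_singleton_iff] at hy
    rcases hy with rfl | rfl
    · rw [map_natCast]; exact Ideal.subset_span rfl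
    · have h0 : theta D (of D (AinfRam.omega D)) = 0 := by
        apply Subtype.ext
        rw [coe_theta, AinfRam.theta_omega]; rfl
      rw [SetLike.mem_coe, h0]; exact Submodule.zero_mem _
  have h := Ideal.mem_map_of_mem (theta D) ha
  rw [Ideal.map_pow] at h
  exact Ideal.pow_right_mono hmap n h

/-- `‖θ_𝒪(a)‖ ≤ ‖p‖ⁿ` for `a ∈ 𝔦ⁿ`. [cite: FontaineAsterisque223III, Exp. II §1.2.2] -/
theorem norm_theta_le_of_mem_pow {n : ℕ} {a : AinfRamTop D} (ha : a ∈ (WithIdeal.i ^ n : Ideal (AinfRamTop D))) :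
    ‖((theta D a : CBall F) : CompletedAlgClosure F)‖ ≤ ‖(p : CompletedAlgClosure F)‖ ^ n := by
  have h := theta_mem_span_pow_of_mem_pow ha
  rw [Ideal.span_singleton_pow, Ideal.mem_span_singleton'] at h
  obtain ⟨b, hb⟩ := h
  rw [← hb, Subring.coe_mul, SubmonoidClass.coe_pow, norm_mul, norm_pow]
  have hb1 : ‖(b : CompletedAlgClosure F)‖ ≤ 1 := (LubinTate.mem_unitBall_iff _).1 b.2
  calc ‖(b : CompletedAlgClosure F)‖ * ‖((p : CBall F) : CompletedAlgClosure F)‖ ^ n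
      ≤ 1 * ‖((p : CBall F) : CompletedAlgClosure F)‖ ^ n := by gcongr
    _ = ‖(p : CompletedAlgClosure F)‖ ^ n := by rw [one_mul]; norm_cast

/-- **`θ_𝒪` is continuous** for the `(p, ω)`-adic topology on `A_inf(𝒪)` and the norm topology on `𝒪_{ℂ_F}`.
[cite: FontaineAsterisque223III, Exp. II §1.3] -/
theorem continuous_theta : Continuous (theta D) := by
  have hp1 : ‖(p : CompletedAlgClosure F)‖ < 1 := norm_natCast_C_lt_one'
  refine continuous_of_continuousAt_zero (theta D) ?_
  rw [ContinuousAt, map_zero, (Ideal.hasBasis_nhds_zero_adic (WithIdeal.i : Ideal (AinfRamTop D))).tendsto_iff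
    Metric.nhds_basis_ball]
  intro ε hε
  obtain ⟨n, hn⟩ := exists_pow_lt_of_lt_one hε hp1
  refine ⟨n, trivial, fun a ha => ?_⟩
  rw [Metric.mem_ball, dist_zero_right]
  exact (norm_theta_le_of_mem_pow ha).trans_lt hn

/-- `θ_𝒪` is surjective on `AinfRamTop` as soon as Fontaine's `θ` is. [cite: FontaineAsterisque223III, Exp. II §1.2.2] -/
theorem theta_surjective (hθ : Function.Surjective (fontaineTheta (integerC F) p)) : Function.Surjective (theta D) := fun y => by
  obtain ⟨a, ha⟩ := AinfRam.theta_surjective D hθ ((integerCEquivCBall (F := F)).symm y)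
  exact ⟨of D a, by rw [theta, RingHom.comp_apply, RingHom.comp_apply]; simp [ha]⟩

/-- **`θ_𝒪(a) = θ_𝒪(b) ⟹ a − b ∈ 𝔦`** (`ker θ_𝒪 = (ω) ⊆ 𝔦`): lifts along `θ_𝒪` are well defined modulo `𝔦`.
[cite: FarguesFontaine2018, §2.2] -/
theorem sub_mem_ideal_of_theta_eq {a b : AinfRamTop D} (h : theta D a = theta D b) :
    a - b ∈ (WithIdeal.i : Ideal (AinfRamTop D)) := by
  have h1 : AinfRam.theta D ((of D).symm (a - b)) = 0 := by
    have h2 : theta D (a - b) = 0 := by rw [map_sub, h, sub_self]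
    have h3 := congrArg (fun y : CBall F => (y : CompletedAlgClosure F)) h2
    exact Subtype.ext h3
  exact of_mem_ideal_of_omega_dvd D (AinfRam.omega_dvd_of_theta_eq_zero D h1)

variable (D) in
/-- **The action of `σ ∈ Γ_F` on `A_inf(𝒪)`** (tree `AinfRam.gal`) on the topological ring `AinfRamTop D`.
[cite: FontaineAsterisque223III, Exp. II §1.2] -/
def gal (σ : absoluteGaloisGroup F) : AinfRamTop D →+* AinfRamTop D :=
  (of D).toRingHom.comp ((AinfRam.gal D σ).comp (of D).symm.toRingHom)

omit [IsAdicComplete (Ideal.span {(p : integerC F)}) (integerC F)] in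
/-- Unfolding `gal`. [cite: FontaineAsterisque223III, Exp. II §1.2] -/
theorem gal_of (σ : absoluteGaloisGroup F) (a : AinfRam D) : gal D σ (of D a) = of D (AinfRam.gal D σ a) := rfl

/-- `θ_𝒪 ∘ σ = σ ∘ θ_𝒪` on `AinfRamTop` (tree `AinfRam.coe_theta_gal`). [cite: FontaineAsterisque223III, Exp. II §1.2] -/
theorem coe_theta_gal (σ : absoluteGaloisGroup F) (a : AinfRamTop D) :
    ((theta D (gal D σ a) : CBall F) : CompletedAlgClosure F) = σ • ((theta D a : CBall F) : CompletedAlgClosure F) :=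
  AinfRam.coe_theta_gal D σ a

/-- `σ` maps `𝔦 = (p, ω)` into itself (`σ p = p`, `σ ω ∈ ker θ_𝒪 = ω A_inf(𝒪)`). [cite: FontaineAsterisque223III, Exp. II §1.2] -/
theorem ideal_map_gal_le (σ : absoluteGaloisGroup F) :
    (WithIdeal.i : Ideal (AinfRamTop D)).map (gal D σ) ≤ WithIdeal.i := by
  rw [ideal_eq, Ideal.map_span, Ideal.span_le]
  rintro _ ⟨y, hy, rfl⟩
  simp only [Set.mem_insert_iff, Set.mem_singleton_iff] at hy
  rcases hy with rfl | rfl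
  · rw [map_natCast]; exact Ideal.subset_span (by simp)
  · rw [SetLike.mem_coe, gal_of]
    exact of_mem_ideal_of_omega_dvd D (AinfRam.omega_dvd_gal_omega D σ)

/-- **`σ` is continuous** on `AinfRamTop` (indeed uniformly continuous). [cite: FontaineAsterisque223III, Exp. II §1.3] -/
theorem continuous_gal (σ : absoluteGaloisGroup F) : Continuous (gal D σ) :=
  (WithIdeal.uniformContinuous_of_map_le (ideal_map_gal_le σ)).continuous

/-! ## §3 The nil ideal `𝔫_𝒪 = θ_𝒪⁻¹(𝔪_{ℂ_F})` -/

/-- If `θ_𝒪(a)^N ∈ p𝒪_{ℂ_F}` then `a^N ∈ 𝔦` (`ker θ_𝒪 ⊆ 𝔦`, `p ∈ 𝔦`). [cite: FontaineAsterisque223III, Exp. II §1.2–§1.3] -/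
theorem pow_mem_ideal_of_theta_pow_mem (hθ : Function.Surjective (fontaineTheta (integerC F) p)) {a : AinfRamTop D} {N : ℕ}
    (h : (theta D a) ^ N ∈ Ideal.span {(p : CBall F)}) : a ^ N ∈ (WithIdeal.i : Ideal (AinfRamTop D)) := by
  obtain ⟨b, hb⟩ := Ideal.mem_span_singleton'.1 h
  obtain ⟨c, hc⟩ := theta_surjective (D := D) hθ b
  rw [← hc] at hb
  have h1 : a ^ N - c * (p : AinfRamTop D) ∈ (WithIdeal.i : Ideal (AinfRamTop D)) :=
    sub_mem_ideal_of_theta_eq (by rw [map_pow, map_mul, map_natCast, hb])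
  have : a ^ N = (a ^ N - c * (p : AinfRamTop D)) + c * (p : AinfRamTop D) := by ring
  rw [this]
  exact Ideal.add_mem _ h1 (Ideal.mul_mem_left _ _ (natCast_mem_ideal D))

/-- **Topological nilpotence of lifts of `𝔪_{ℂ_F}`**: if `‖θ_𝒪(a)‖ < 1` then `a^N ∈ 𝔦` for some `N`.
[cite: FontaineAsterisque223III, Exp. II §1.3] -/
theorem exists_pow_mem_ideal_of_norm_lt_one (hθ : Function.Surjective (fontaineTheta (integerC F) p)) {a : AinfRamTop D}
    (ha : ‖((theta D a : CBall F) : CompletedAlgClosure F)‖ < 1) : ∃ N : ℕ, a ^ N ∈ (WithIdeal.i : Ideal (AinfRamTop D)) := by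
  have hp0 : (p : CompletedAlgClosure F) ≠ 0 := natCast_C_ne_zero (Fact.out : p.Prime).ne_zero
  obtain ⟨N, hN⟩ := exists_pow_lt_of_lt_one (norm_pos_iff.2 hp0) ha
  refine ⟨N, pow_mem_ideal_of_theta_pow_mem hθ (Ideal.mem_span_singleton'.2 ?_)⟩
  refine ⟨⟨((theta D a : CBall F) : CompletedAlgClosure F) ^ N / (p : CompletedAlgClosure F), ?_⟩, Subtype.ext ?_⟩
  · rw [LubinTate.mem_unitBall_iff, norm_div, norm_pow, div_le_one (norm_pos_iff.2 hp0)]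
    exact hN.le
  · change _ / _ * ((p : CBall F) : CompletedAlgClosure F) = ((theta D a : CBall F) : CompletedAlgClosure F) ^ N
    push_cast
    rw [div_mul_cancel₀ _ hp0]

variable (D) in
/-- **The ideal `𝔫_𝒪 = θ_𝒪⁻¹(𝔪_{ℂ_F}) = {a ∈ A_inf(𝒪) : ‖θ_𝒪(a)‖ < 1}`** as a closed ideal of topologically nilpotent
elements of `AinfRamTop D`: the domain of the points of `𝒪`-formal groups with values in `A_inf(𝒪)`.
[cite: FontaineAsterisque223III, Exp. II §1.2–§1.3] [cite: CasselsFrohlichANT1967, Ch. VI §3.2] -/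
def nilTheta (hθ : Function.Surjective (fontaineTheta (integerC F) p)) : NilIdeal (AinfRamTop D) where
  toIdeal := (maxNilIdealC F).toIdeal.comap (theta D)
  isClosed := (maxNilIdealC F).isClosed.preimage continuous_theta
  isTopologicallyNilpotent a ha := by
    obtain ⟨N, hN⟩ := exists_pow_mem_ideal_of_norm_lt_one hθ ha
    exact isTopologicallyNilpotent_of_pow_mem hN

/-- Membership in `𝔫_𝒪`: `‖θ_𝒪(a)‖ < 1`. [cite: FontaineAsterisque223III, Exp. II §1.2.2] -/
theorem mem_nilTheta_iff {hθ : Function.Surjective (fontaineTheta (integerC F) p)} {a : AinfRamTop D} :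
    a ∈ (nilTheta D hθ).toIdeal ↔ ‖((theta D a : CBall F) : CompletedAlgClosure F)‖ < 1 := Iff.rfl

/-- `θ_𝒪` maps `𝔫_𝒪` into `𝔪_{ℂ_F}`. [cite: FontaineAsterisque223III, Exp. II §1.2.2] -/
theorem theta_mem_maxNilIdealC {hθ : Function.Surjective (fontaineTheta (integerC F) p)} {a : AinfRamTop D}
    (ha : a ∈ (nilTheta D hθ).toIdeal) : theta D a ∈ (maxNilIdealC F).toIdeal := ha

/-- `𝔦 ⊆ 𝔫_𝒪` (`θ_𝒪(𝔦) = p𝒪_{ℂ_F}`). [cite: FontaineAsterisque223III, Exp. II §1.2.2] -/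
theorem ideal_le_nilTheta {hθ : Function.Surjective (fontaineTheta (integerC F) p)} :
    (WithIdeal.i : Ideal (AinfRamTop D)) ≤ (nilTheta D hθ).toIdeal := fun a ha => by
  rw [mem_nilTheta_iff]
  have h := norm_theta_le_of_mem_pow (n := 1) (by rwa [pow_one])
  rw [pow_one] at h
  exact h.trans_lt norm_natCast_C_lt_one'

/-- **`θ_𝒪 : 𝔫_𝒪 → 𝔪_{ℂ_F}` is onto.** [cite: FontaineAsterisque223III, Exp. II §1.2.2] -/
theorem exists_theta_eq {hθ : Function.Surjective (fontaineTheta (integerC F) p)} (y : (maxNilIdealC F).toIdeal) :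
    ∃ x : (nilTheta D hθ).toIdeal, theta D (x : AinfRamTop D) = y := by
  obtain ⟨a, ha⟩ := theta_surjective hθ (y : CBall F)
  exact ⟨⟨a, show a ∈ (nilTheta D hθ).toIdeal by rw [mem_nilTheta_iff, ha]; exact y.2⟩, ha⟩

/-- `𝔫_𝒪` is `Γ_F`-stable (`‖θ_𝒪(σ a)‖ = ‖σ θ_𝒪(a)‖ = ‖θ_𝒪(a)‖`). [cite: FontaineAsterisque223III, Exp. II §1.2] -/
theorem gal_mem_nilTheta {hθ : Function.Surjective (fontaineTheta (integerC F) p)} (σ : absoluteGaloisGroup F)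
    {a : AinfRamTop D} (ha : a ∈ (nilTheta D hθ).toIdeal) : gal D σ a ∈ (nilTheta D hθ).toIdeal := by
  rw [mem_nilTheta_iff, coe_theta_gal, CompletedAlgClosure.norm_smul]
  exact ha

/-- **`ϖ ∈ 𝔫_𝒪`** (`‖θ_𝒪(ϖ)‖ = ‖ϖ‖ < 1`): the uniformizer is a point of every `𝒪`-formal group. [cite: FarguesFontaine2018, §2.2] -/
theorem of_varpi_mem_nilTheta {hθ : Function.Surjective (fontaineTheta (integerC F) p)} :
    of D (AinfRam.varpi D) ∈ (nilTheta D hθ).toIdeal := by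
  rw [mem_nilTheta_iff, coe_theta, AinfRam.theta_varpi]
  exact D.norm_rootC_lt_one

end AinfRamTop

end Literature.NumberTheory.PAdicHodge

end
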